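import Mathlib.CategoryTheory.Extensive
import Mathlib.CategoryTheory.Galois.Decomposition
import Mathlib.CategoryTheory.Subobject.Basic
import Mathlib.CategoryTheory.Limits.ConcreteCategory.Basic
import Literature.AnabelianGeometry.Anabelioids.OverPullbackExact
import Literature.AnabelianGeometry.Anabelioids.ComponentsOfObjects
import HarnessLib

/-!
# An object of a connected anabelioid is the disjoint union of its connected components (brick G1 of G25⁺)

Mochizuki, *Semi-graphs of anabelioids*, Publ. RIMS **42** (2006), §2 p. 23
[cite: MochizukiSemiAnbd2006, Def. 2.2(i) p.23], with [SGA1, Exp. V §4]: the finite étale covering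
`𝒢' → 𝒢` of an object `A = {S_v, T_e, ψ_b}` of `B(𝒢)` has "vertices over `v` the connected components
of `S_v`", and `B(𝒢') = B(𝒢)_{/A}` (the global clause, `Hom.IsBObjCoveringOf`) rests on the fact that
an object of a Galois category is the coproduct of its connected components, universally and
disjointly.  With the cell's rendering of the set of components of `S` as the connected subobjects
`{P : Subobject S // IsConnected P}` (`π₀Obj S`), this proof-only file records:

* `exists_iso_summand_of_isConnected` — a connected subobject of `S` is (compatibly isomorphic to) a
  summand of any decomposition of `S` into connected objects;
* `isColimit_cofan_components` — `S` is the coproduct of its connected components, with the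
  inclusions `P.arrow` as injections;
* `isColimit_cofan_pullback_components` — universality: every `Y → S` is the coproduct of its
  restrictions `Y ×_S P → P` to the components (Galois categories are finitary extensive,
  abc-iut-L3-t6 `finitaryExtensive_of_galoisCategory`);
* `isInitial_pullback_components_of_ne` — distinct components are disjoint (and `P ×_S P ⥲ P` is
  Mathlib's instance `fst_iso_of_mono_eq`).
-/

namespace Literature.AnabelianGeometry.Anabelioids

open CategoryTheory CategoryTheory.Limits CategoryTheory.PreGaloisCategory

universe v₁ u₁

variable {C : Type u₁} [Category.{v₁} C] [GaloisCategory C]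

/-- A connected subobject `P` of `S` is a summand of any decomposition `S = ∐ᵢ Xᵢ` into connected
objects: `P ≅ Xᵢ` over `S` for some `i` (a point of the fibre of `P` lies in the fibre of some `Xᵢ`;
then both projections of `P ×_S Xᵢ` are monomorphisms with nonempty fibre into connected objects).
[cite: SGA1, Exp. V §4 (condition (G3))] -/
theorem exists_iso_summand_of_isConnected {S : C} {ι : Type*} [Finite ι] {X : ι → C} (g : ∀ i, X i ⟶ S)
    (hc : IsColimit (Cofan.mk S g)) (hX : ∀ i, IsConnected (X i)) [∀ i, Mono (g i)]
    (P : Subobject S) [IsConnected (P : C)] :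
    ∃ (i : ι) (e : (P : C) ≅ X i), e.hom ≫ g i = P.arrow := by
  let F := GaloisCategory.getFiberFunctor C
  obtain ⟨p⟩ := nonempty_fiber_of_isConnected F (P : C)
  -- the image of `p` in the fibre of `S` comes from some summand
  obtain ⟨⟨i⟩, z, hz⟩ := Concrete.isColimit_exists_rep (Discrete.functor X ⋙ F)
    (isColimitOfPreserves F hc) (F.map P.arrow p)
  change F.map (g i) z = F.map P.arrow p at hz
  haveI := hX i
  let r : F.obj (pullback P.arrow (g i)) := (fiberPullbackEquiv F P.arrow (g i)).symm ⟨(p, z), hz.symm⟩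
  have hni : IsInitial (pullback P.arrow (g i)) → False := not_initial_of_inhabited F r
  haveI : IsIso (pullback.fst P.arrow (g i)) := IsConnected.noTrivialComponent _ _ hni
  haveI : IsIso (pullback.snd P.arrow (g i)) := IsConnected.noTrivialComponent _ _ hni
  refine ⟨i, (asIso (pullback.fst P.arrow (g i))).symm ≪≫ asIso (pullback.snd P.arrow (g i)), ?_⟩
  change (inv (pullback.fst P.arrow (g i)) ≫ pullback.snd P.arrow (g i)) ≫ g i = P.arrow
  rw [Category.assoc, ← pullback.condition, IsIso.inv_hom_id_assoc]

/-- In a decomposition `S = ∐ᵢ Xᵢ` into connected objects, a connected subobject is a summand for a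
UNIQUE index (distinct summands are disjoint: extensivity). [cite: SGA1, Exp. V §4 (condition (G3))] -/
theorem summand_index_unique {S : C} {ι : Type*} [Finite ι] {X : ι → C} (g : ∀ i, X i ⟶ S)
    (hc : IsColimit (Cofan.mk S g)) (P : Subobject S) [IsConnected (P : C)] {i j : ι}
    (e : (P : C) ≅ X i) (he : e.hom ≫ g i = P.arrow) (e' : (P : C) ≅ X j)
    (he' : e'.hom ≫ g j = P.arrow) : i = j := by
  haveI := finitaryExtensive_of_galoisCategory C
  by_contra hij
  have hsq := FinitaryExtensive.isPullback_initial_to hc ⟨i⟩ ⟨j⟩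
    (fun h => hij (congrArg Discrete.as h))
  -- `P` maps to both summands compatibly, hence to their (initial) intersection
  have w : e.hom ≫ (Cofan.mk S g).ι.app ⟨i⟩ = e'.hom ≫ (Cofan.mk S g).ι.app ⟨j⟩ := by
    change e.hom ≫ g i = e'.hom ≫ g j
    rw [he, he']
  let t : (P : C) ⟶ ⊥_ C := hsq.lift e.hom e'.hom w
  let F := GaloisCategory.getFiberFunctor C
  obtain ⟨p⟩ := nonempty_fiber_of_isConnected F (P : C)
  exact not_initial_of_inhabited F (F.map t p) initialIsInitial

/-- **An object of a Galois category is the coproduct of its connected components**: the cofan on `S`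
with injections the inclusions `P ↪ S` of the connected subobjects is a colimit.
[cite: MochizukiSemiAnbd2006, Def. 2.2(i) p.23] -/
theorem isColimit_cofan_components (S : C) :
    Nonempty (IsColimit (Cofan.mk S
      (fun P : {P : Subobject S // IsConnected (P : C)} => P.1.arrow))) := by
  classical
  obtain ⟨ι, X, g, hc, hX, hfin⟩ := has_decomp_connected_components S
  haveI : ∀ i, Mono (g i) := fun i => MonoCoprod.mono_inj X (Cofan.mk S g) hc i
  haveI : ∀ i, IsConnected (X i) := hX
  -- the summands, as connected subobjects
  let m : ι → {P : Subobject S // IsConnected (P : C)} := fun i =>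
    ⟨Subobject.mk (g i), isConnected_of_iso (Subobject.underlyingIso (g i)).symm⟩
  have hm_surj : Function.Surjective m := by
    intro P
    haveI := P.2
    obtain ⟨i, e, he⟩ := exists_iso_summand_of_isConnected g hc hX P.1
    refine ⟨i, Subtype.ext ?_⟩
    change Subobject.mk (g i) = P.1
    exact Subobject.mk_eq_of_comm (g i) e.symm ((Iso.inv_comp_eq e).mpr he.symm)
  have hm_inj : Function.Injective m := by
    intro i j hij
    have hPj : (Subobject.mk (g i) : Subobject S) = Subobject.mk (g j) := congrArg Subtype.val hij
    haveI : IsConnected (Subobject.mk (g i) : C) := (m i).2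
    refine summand_index_unique g hc (Subobject.mk (g i)) (Subobject.underlyingIso (g i))
      (Subobject.underlyingIso_hom_comp_eq_mk (g i))
      (Subobject.isoOfEq _ _ hPj ≪≫ Subobject.underlyingIso (g j)) ?_
    rw [Iso.trans_hom, Category.assoc, Subobject.underlyingIso_hom_comp_eq_mk, Subobject.isoOfEq_hom,
      Subobject.ofLE_arrow]
  let ε : ι ≃ {P : Subobject S // IsConnected (P : C)} := Equiv.ofBijective m ⟨hm_inj, hm_surj⟩
  refine ⟨Cofan.IsColimit.mk _
    (fun s => hc.desc (Cofan.mk s.pt (fun i => (Subobject.underlyingIso (g i)).inv ≫ s.inj (ε i))))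
    (fun s P => ?_) (fun s k hk => ?_)⟩
  · obtain ⟨i, rfl⟩ := ε.surjective P
    have hfac := hc.fac (Cofan.mk s.pt (fun i => (Subobject.underlyingIso (g i)).inv ≫ s.inj (ε i))) ⟨i⟩
    change g i ≫ _ = (Subobject.underlyingIso (g i)).inv ≫ s.inj (ε i) at hfac
    change (Subobject.mk (g i)).arrow ≫ _ = s.inj (ε i)
    rw [← Subobject.underlyingIso_hom_comp_eq_mk, Category.assoc, hfac, Iso.hom_inv_id_assoc]
  · refine hc.hom_ext fun ⟨i⟩ => ?_
    have hfac := hc.fac (Cofan.mk s.pt (fun i => (Subobject.underlyingIso (g i)).inv ≫ s.inj (ε i))) ⟨i⟩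
    change g i ≫ _ = (Subobject.underlyingIso (g i)).inv ≫ s.inj (ε i) at hfac
    change g i ≫ k = g i ≫ _
    rw [hfac, ← hk (ε i)]
    change g i ≫ k = (Subobject.underlyingIso (g i)).inv ≫ (Subobject.mk (g i)).arrow ≫ k
    rw [Subobject.underlyingIso_arrow_assoc]

/-- **Universality**: every object `Y → S` over `S` is the coproduct of its restrictions
`Y ×_S P → P` to the connected components `P` of `S` (coproducts in a Galois category are stable
under pull-back). [cite: MochizukiSemiAnbd2006, Def. 2.2(i) p.23] -/
theorem isColimit_cofan_pullback_components {S Y : C} (f : Y ⟶ S) :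
    Nonempty (IsColimit (Cofan.mk Y
      (fun P : {P : Subobject S // IsConnected (P : C)} => pullback.fst f P.1.arrow))) := by
  haveI := finitaryExtensive_of_galoisCategory C
  haveI := finite_connectedSubobject S
  obtain ⟨hc⟩ := isColimit_cofan_components S
  have hU := FinitaryPreExtensive.isUniversal_finiteCoproducts hc
  refine hU (Cofan.mk Y (fun P : {P : Subobject S // IsConnected (P : C)} => pullback.fst f P.1.arrow))
    (Discrete.natTrans fun P => pullback.snd f P.as.1.arrow) f ?_
    (NatTrans.Equifibered.of_discrete _) fun ⟨P⟩ => ?_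
  · ext ⟨P⟩
    change pullback.snd f P.1.arrow ≫ P.1.arrow = pullback.fst f P.1.arrow ≫ f
    exact pullback.condition.symm
  · exact IsPullback.of_hasPullback f P.1.arrow

/-- **Distinct connected components are disjoint**: `P ×_S P'` is initial for `P ≠ P'`.
[cite: SGA1, Exp. V §4 (condition (G3))] -/
theorem isInitial_pullback_components_of_ne {S : C} (P P' : {P : Subobject S // IsConnected (P : C)})
    (h : P ≠ P') : Nonempty (IsInitial (pullback P.1.arrow P'.1.arrow)) := by
  by_contra hne
  have hni : IsInitial (pullback P.1.arrow P'.1.arrow) → False := fun hi => hne ⟨hi⟩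
  haveI := P.2
  haveI := P'.2
  haveI : IsIso (pullback.fst P.1.arrow P'.1.arrow) := IsConnected.noTrivialComponent _ _ hni
  haveI : IsIso (pullback.snd P.1.arrow P'.1.arrow) := IsConnected.noTrivialComponent _ _ hni
  apply h
  apply Subtype.ext
  apply le_antisymm
  · refine Subobject.le_of_comm (inv (pullback.fst P.1.arrow P'.1.arrow) ≫ pullback.snd _ _) ?_
    rw [Category.assoc, ← pullback.condition, IsIso.inv_hom_id_assoc]
  · refine Subobject.le_of_comm (inv (pullback.snd P.1.arrow P'.1.arrow) ≫ pullback.fst _ _) ?_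
    rw [Category.assoc, pullback.condition, IsIso.inv_hom_id_assoc]

end Literature.AnabelianGeometry.Anabelioids
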